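import Mathlib.Analysis.Complex.AbelLimit
import Mathlib.Analysis.SpecialFunctions.Complex.Arctan
import Mathlib.Algebra.BigOperators.Module
import Mathlib.Algebra.Order.Floor.Semiring
import HarnessLib

/-!
# The sine series of the square wave: `Σ_{n<M} sin((2n+1)x)/(2n+1)` is bounded by `3` and tends to `±π/4`

Topic `Literature/Analysis/Fourier`.  The Fourier series of the square wave `sgn(sin x)` is
`(4/π) Σ_{n ≥ 0} sin((2n+1)x)/(2n+1)`; this file proves the two classical facts about its PARTIAL SUMS
`S_M(x) = Σ_{n<M} sin((2n+1)x)/(2n+1)` that make "bounded pointwise convergence" arguments work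
(dominated convergence against the square wave, e.g. the `M → ∞` limit of truncated fermionic Matsubara
sums, where `(1/β) Σ_{|ω|<πM/β…} e^{-iωτ}/(iω) = -(2/π) S_M(πτ/β)`):

* `abs_sum_sin_odd_div_le_three` — the UNIFORM bound `|S_M(x)| ≤ 3` for all `M` and all real `x`
  (head `n < ⌈1/|sin x|⌉` by `|sin((2n+1)x)| ≤ (2n+1)|sin x|`, tail by Abel summation against the
  closed form `sin x · Σ_{n<N} sin((2n+1)x) = sin²(Nx)`);
* `tendsto_sum_sin_odd_div_of_sin_pos` / `_of_sin_neg` / `sum_sin_odd_div_of_sin_eq_zero` — the limit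
  `S_M(x) → π/4` if `sin x > 0`, `→ -π/4` if `sin x < 0`, and `S_M(x) = 0` if `sin x = 0`.

The limit is obtained exactly as Mathlib's Leibniz series `Real.tendsto_sum_pi_div_four` (the case
`x = π/2`): Dirichlet's test gives convergence to some `l`, Abel's limit theorem
(`Real.tendsto_tsum_powerSeries_nhdsWithin_lt`) identifies `l` with the boundary value of
`Im Σ_n z^{2n+1}/(2n+1) = Im(-½ log((1-z)/(1+z)))`, `z = r e^{ix}`, `r → 1⁻`, and at `z = e^{ix}` the
argument of `(1-z)/(1+z) = -2i sin x/|1+z|²` is `-π/2`.  Also recorded: the general Abel tail inequality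
`‖Σ_{m ≤ i < n} a_i • b_i‖ ≤ 2 B a_m` (`norm_sum_Ico_smul_le_of_antitone`) and `|sin((2n+1)x)| ≤ (2n+1)|sin x|`.

Everything is proved; no definitions, no named facts.  Mathlib has neither the square-wave series nor a
Dirichlet–Jordan theorem (searched `squareWave`, `sawtooth`, `sin_div`, `dirichletKernel`); the tree's
`FejerSquareWave.lean` treats the Fejér MEANS (no Gibbs phenomenon), not the partial sums.

## Sources

A. Zygmund, *Trigonometric Series* (2nd ed.), Vol. I, Ch. I (1.10) (Abel's transformation and the bound
`|Σ a_ν b_ν| ≤ 2 B a_m`), Ch. II §9 (the series `Σ sin((2n+1)x)/(2n+1) = π/4`, `0 < x < π`, and the uniform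
boundedness of its partial sums). [folklore]
-/

noncomputable section

open Filter Finset Complex
open scoped Real Topology

namespace Literature.Analysis.Fourier

/-! ### Trigonometric preliminaries -/

/-- `|sin ((2n+1) x)| ≤ (2n+1) |sin x|` (from `|sin((k+1)x)| ≤ |sin(kx)| + |sin x|`, i.e.
`|sin(kx)| ≤ k|sin x|` for every natural `k`). [folklore] -/
theorem abs_sin_odd_mul_le (n : ℕ) (x : ℝ) :
    |Real.sin ((2 * n + 1) * x)| ≤ (2 * n + 1) * |Real.sin x| := by
  -- the general bound `|sin(kx)| ≤ k|sin x|` by induction on `k`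
  have aux : ∀ k : ℕ, |Real.sin (k * x)| ≤ k * |Real.sin x| := by
    intro k
    induction k with
    | zero => simp
    | succ k ih =>
      have h : Real.sin ((k + 1 : ℕ) * x) =
          Real.sin (k * x) * Real.cos x + Real.cos (k * x) * Real.sin x := by
        push_cast
        rw [add_mul, one_mul, Real.sin_add]
      rw [h]
      calc |Real.sin (k * x) * Real.cos x + Real.cos (k * x) * Real.sin x|
          ≤ |Real.sin (k * x) * Real.cos x| + |Real.cos (k * x) * Real.sin x| := abs_add_le _ _
        _ = |Real.sin (k * x)| * |Real.cos x| + |Real.cos (k * x)| * |Real.sin x| := by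
            rw [abs_mul, abs_mul]
        _ ≤ |Real.sin (k * x)| * 1 + 1 * |Real.sin x| := by
            gcongr
            · exact Real.abs_cos_le_one _
            · exact Real.abs_cos_le_one _
        _ ≤ k * |Real.sin x| * 1 + 1 * |Real.sin x| := by gcongr
        _ = ((k + 1 : ℕ) : ℝ) * |Real.sin x| := by push_cast; ring
  have h := aux (2 * n + 1)
  push_cast at h
  exact h

/-- `sin (a + b) sin (a - b) = sin² a − sin² b`. [folklore] -/
theorem sin_add_mul_sin_sub (a b : ℝ) :
    Real.sin (a + b) * Real.sin (a - b) = Real.sin a ^ 2 - Real.sin b ^ 2 := by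
  rw [Real.sin_add, Real.sin_sub]
  calc (Real.sin a * Real.cos b + Real.cos a * Real.sin b) * (Real.sin a * Real.cos b - Real.cos a * Real.sin b)
      = Real.sin a ^ 2 * Real.cos b ^ 2 - Real.cos a ^ 2 * Real.sin b ^ 2 := by ring
    _ = Real.sin a ^ 2 * (1 - Real.sin b ^ 2) - (1 - Real.sin a ^ 2) * Real.sin b ^ 2 := by
        rw [Real.cos_sq', Real.cos_sq']
    _ = Real.sin a ^ 2 - Real.sin b ^ 2 := by ring

/-- **Closed form of the odd sine sum**: `sin x · Σ_{n<N} sin((2n+1)x) = sin²(Nx)` (the conjugate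
Dirichlet-type kernel; telescoping `sin((2n+1)x) sin x = sin²((n+1)x) − sin²(nx)`). [folklore] -/
theorem sin_mul_sum_sin_odd (N : ℕ) (x : ℝ) :
    Real.sin x * ∑ n ∈ range N, Real.sin ((2 * n + 1) * x) = Real.sin (N * x) ^ 2 := by
  induction N with
  | zero => simp
  | succ N ih =>
    rw [sum_range_succ, mul_add, ih]
    have h := sin_add_mul_sin_sub (((N + 1 : ℕ) : ℝ) * x) (N * x)
    have e1 : ((N + 1 : ℕ) : ℝ) * x + N * x = (2 * N + 1) * x := by push_cast; ring
    have e2 : ((N + 1 : ℕ) : ℝ) * x - N * x = x := by push_cast; ring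
    rw [e1, e2] at h
    linarith [mul_comm (Real.sin x) (Real.sin ((2 * N + 1) * x))]

/-- **The odd sine sums are bounded by `1/|sin x|`**: `|Σ_{n<N} sin((2n+1)x)| ≤ 1/|sin x|`
(`sin x ≠ 0`), uniformly in `N`. [folklore] -/
theorem abs_sum_sin_odd_le {x : ℝ} (hx : Real.sin x ≠ 0) (N : ℕ) :
    |∑ n ∈ range N, Real.sin ((2 * n + 1) * x)| ≤ 1 / |Real.sin x| := by
  have hs : 0 < |Real.sin x| := abs_pos.2 hx
  rw [le_div_iff₀ hs, ← abs_mul, mul_comm, sin_mul_sum_sin_odd N x, abs_of_nonneg (sq_nonneg _)]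
  exact Real.sin_sq_le_one _

/-! ### Abel summation: the tail inequality -/

/-- **Abel's inequality for tails**: if `a` is antitone and nonnegative and all partial sums of `b` have
norm `≤ B`, then `‖Σ_{m ≤ i < n} a_i • b_i‖ ≤ 2 B a_m` (Zygmund, *Trigonometric Series* I, (1.10)). [folklore] -/
theorem norm_sum_Ico_smul_le_of_antitone {E : Type*} [SeminormedAddCommGroup E] [NormedSpace ℝ E]
    {a : ℕ → ℝ} {b : ℕ → E} {B : ℝ} (ha : Antitone a) (ha0 : ∀ n, 0 ≤ a n)
    (hb : ∀ n, ‖∑ i ∈ range n, b i‖ ≤ B) (m n : ℕ) :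
    ‖∑ i ∈ Ico m n, a i • b i‖ ≤ 2 * B * a m := by
  have hB : 0 ≤ B := (norm_nonneg _).trans (hb 0)
  rcases lt_or_ge m n with hmn | hnm
  · rw [Finset.sum_Ico_by_parts a b hmn]
    have h1 : ‖a (n - 1) • ∑ i ∈ range n, b i‖ ≤ a (n - 1) * B := by
      rw [norm_smul, Real.norm_of_nonneg (ha0 _)]
      exact mul_le_mul_of_nonneg_left (hb n) (ha0 _)
    have h2 : ‖a m • ∑ i ∈ range m, b i‖ ≤ a m * B := by
      rw [norm_smul, Real.norm_of_nonneg (ha0 _)]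
      exact mul_le_mul_of_nonneg_left (hb m) (ha0 _)
    have h3 : ‖∑ i ∈ Ico m (n - 1), (a (i + 1) - a i) • ∑ j ∈ range (i + 1), b j‖ ≤
        (a m - a (n - 1)) * B := by
      calc ‖∑ i ∈ Ico m (n - 1), (a (i + 1) - a i) • ∑ j ∈ range (i + 1), b j‖
          ≤ ∑ i ∈ Ico m (n - 1), ‖(a (i + 1) - a i) • ∑ j ∈ range (i + 1), b j‖ := norm_sum_le _ _
        _ ≤ ∑ i ∈ Ico m (n - 1), (a i - a (i + 1)) * B := by
            refine sum_le_sum fun i _ => ?_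
            rw [norm_smul, Real.norm_eq_abs, abs_sub_comm, abs_of_nonneg (sub_nonneg.2 (ha (Nat.le_succ i)))]
            exact mul_le_mul_of_nonneg_left (hb _) (sub_nonneg.2 (ha (Nat.le_succ i)))
        _ = (a m - a (n - 1)) * B := by
            rw [← sum_mul, Finset.sum_Ico_eq_sum_range]
            congr 1
            have tel := Finset.sum_range_sub' (fun k => a (m + k)) (n - 1 - m)
            rw [add_zero, show m + (n - 1 - m) = n - 1 by omega] at tel
            rw [← tel]
            exact Finset.sum_congr rfl fun k _ => by rw [add_assoc]
    calc ‖a (n - 1) • ∑ i ∈ range n, b i - a m • ∑ i ∈ range m, b i -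
          ∑ i ∈ Ico m (n - 1), (a (i + 1) - a i) • ∑ j ∈ range (i + 1), b j‖
        ≤ ‖a (n - 1) • ∑ i ∈ range n, b i‖ + ‖a m • ∑ i ∈ range m, b i‖ +
          ‖∑ i ∈ Ico m (n - 1), (a (i + 1) - a i) • ∑ j ∈ range (i + 1), b j‖ := by
          refine (norm_sub_le _ _).trans ?_
          gcongr
          exact norm_sub_le _ _
      _ ≤ a (n - 1) * B + a m * B + (a m - a (n - 1)) * B := by gcongr
      _ = 2 * B * a m := by ring
  · rw [Finset.Ico_eq_empty_of_le hnm, sum_empty, norm_zero]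
    exact mul_nonneg (mul_nonneg zero_le_two hB) (ha0 m)

/-! ### The uniform bound `|S_M(x)| ≤ 3` -/

/-- If `sin x = 0` every term of the odd sine series vanishes. [folklore] -/
theorem sin_odd_mul_eq_zero_of_sin_eq_zero {x : ℝ} (hx : Real.sin x = 0) (n : ℕ) :
    Real.sin ((2 * n + 1) * x) = 0 := by
  have h := abs_sin_odd_mul_le n x
  rw [hx, abs_zero, mul_zero] at h
  exact abs_eq_zero.1 (le_antisymm h (abs_nonneg _))

/-- The case `sin x = 0`: `S_M(x) = 0`. [folklore] -/
theorem sum_sin_odd_div_of_sin_eq_zero {x : ℝ} (hx : Real.sin x = 0) (M : ℕ) :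
    ∑ n ∈ range M, Real.sin ((2 * n + 1) * x) / (2 * n + 1) = 0 :=
  sum_eq_zero fun n _ => by rw [sin_odd_mul_eq_zero_of_sin_eq_zero hx, zero_div]

/-- The head of the series: `|Σ_{n<K} sin((2n+1)x)/(2n+1)| ≤ K |sin x|`. [folklore] -/
theorem abs_sum_sin_odd_div_le_mul (K : ℕ) (x : ℝ) :
    |∑ n ∈ range K, Real.sin ((2 * n + 1) * x) / (2 * n + 1)| ≤ K * |Real.sin x| := by
  calc |∑ n ∈ range K, Real.sin ((2 * n + 1) * x) / (2 * n + 1)|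
      ≤ ∑ n ∈ range K, |Real.sin ((2 * n + 1) * x) / (2 * n + 1)| := abs_sum_le_sum_abs _ _
    _ ≤ ∑ _n ∈ range K, |Real.sin x| := by
        refine sum_le_sum fun n _ => ?_
        have hpos : (0 : ℝ) < 2 * n + 1 := by positivity
        rw [abs_div, abs_of_pos hpos, div_le_iff₀ hpos]
        calc |Real.sin ((2 * n + 1) * x)| ≤ (2 * n + 1) * |Real.sin x| := abs_sin_odd_mul_le n x
          _ = |Real.sin x| * (2 * n + 1) := by ring
    _ = K * |Real.sin x| := by rw [sum_const, card_range, nsmul_eq_mul]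

/-- The tail of the series by Abel summation: `|Σ_{N ≤ n < M} sin((2n+1)x)/(2n+1)| ≤ 2/((2N+1)|sin x|)`
(`sin x ≠ 0`). [folklore] -/
theorem abs_sum_Ico_sin_odd_div_le {x : ℝ} (hx : Real.sin x ≠ 0) (N M : ℕ) :
    |∑ n ∈ Ico N M, Real.sin ((2 * n + 1) * x) / (2 * n + 1)| ≤ 2 / ((2 * N + 1) * |Real.sin x|) := by
  have ha : Antitone fun n : ℕ => 1 / (2 * (n : ℝ) + 1) := fun m n hmn =>
    one_div_le_one_div_of_le (by positivity) (by simpa using (Nat.cast_le (α := ℝ)).2 hmn)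
  have h := norm_sum_Ico_smul_le_of_antitone (E := ℝ) (b := fun n : ℕ => Real.sin ((2 * n + 1) * x))
    ha (fun n => by positivity) (fun n => (Real.norm_eq_abs _).le.trans (abs_sum_sin_odd_le hx n)) N M
  have heq : ∑ i ∈ Ico N M, (1 / (2 * (i : ℝ) + 1)) • Real.sin ((2 * i + 1) * x) =
      ∑ n ∈ Ico N M, Real.sin ((2 * n + 1) * x) / (2 * n + 1) :=
    sum_congr rfl fun i _ => by rw [smul_eq_mul]; ring
  rw [heq, Real.norm_eq_abs] at h
  refine h.trans (le_of_eq ?_)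
  have hpos : (0 : ℝ) < 2 * N + 1 := by positivity
  field_simp

/-- **Uniform boundedness of the square-wave partial sums**: `|Σ_{n<M} sin((2n+1)x)/(2n+1)| ≤ 3` for
every `M` and every real `x` (Zygmund, *Trigonometric Series* I, Ch. II §9; the sharp constant is the
Wilbraham–Gibbs value `½ ∫₀^π (sin t)/t dt ≈ 0.926`). [folklore] -/
theorem abs_sum_sin_odd_div_le_three (M : ℕ) (x : ℝ) :
    |∑ n ∈ range M, Real.sin ((2 * n + 1) * x) / (2 * n + 1)| ≤ 3 := by
  by_cases hx : Real.sin x = 0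
  · rw [sum_sin_odd_div_of_sin_eq_zero hx]; norm_num
  set s := |Real.sin x| with hs_def
  have hs : 0 < s := abs_pos.2 hx
  have hs1 : s ≤ 1 := Real.abs_sin_le_one x
  set N := ⌈1 / s⌉₊ with hN_def
  have hN : 1 / s ≤ N := Nat.le_ceil _
  have hN' : (N : ℝ) < 1 / s + 1 := Nat.ceil_lt_add_one (by positivity)
  -- the head: any `K ≤ N` terms are bounded by `K s ≤ N s < 1 + s ≤ 2`
  have head : ∀ K : ℕ, K ≤ N → |∑ n ∈ range K, Real.sin ((2 * n + 1) * x) / (2 * n + 1)| ≤ 2 := by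
    intro K hK
    refine (abs_sum_sin_odd_div_le_mul K x).trans ?_
    have hKN : (K : ℝ) ≤ N := by exact_mod_cast hK
    calc (K : ℝ) * s ≤ N * s := mul_le_mul_of_nonneg_right hKN hs.le
      _ ≤ (1 / s + 1) * s := mul_le_mul_of_nonneg_right hN'.le hs.le
      _ = 1 + s := by field_simp
      _ ≤ 2 := by linarith
  rcases le_or_gt M N with hMN | hNM
  · exact (head M hMN).trans (by norm_num)
  · rw [← sum_range_add_sum_Ico _ hNM.le]
    have tail : |∑ n ∈ Ico N M, Real.sin ((2 * n + 1) * x) / (2 * n + 1)| ≤ 1 := by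
      refine (abs_sum_Ico_sin_odd_div_le hx N M).trans ?_
      have h2 : 2 ≤ (2 * N + 1) * s := by
        have : 1 ≤ (N : ℝ) * s := by
          have := mul_le_mul_of_nonneg_right hN hs.le
          rwa [one_div_mul_cancel hs.ne'] at this
        nlinarith
      rw [div_le_one (by positivity)]
      exact h2
    calc |∑ n ∈ range N, Real.sin ((2 * n + 1) * x) / (2 * n + 1) +
          ∑ n ∈ Ico N M, Real.sin ((2 * n + 1) * x) / (2 * n + 1)|
        ≤ |∑ n ∈ range N, Real.sin ((2 * n + 1) * x) / (2 * n + 1)| +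
          |∑ n ∈ Ico N M, Real.sin ((2 * n + 1) * x) / (2 * n + 1)| := abs_add_le _ _
      _ ≤ 2 + 1 := add_le_add (head N le_rfl) tail
      _ = 3 := by norm_num

/-! ### The generating function `Σ z^{2n+1}/(2n+1) = -½ log((1-z)/(1+z))` -/

/-- **The odd logarithmic series**: for `‖z‖ < 1`, `Σ_n z^{2n+1}/(2n+1) = -½ log((1 − z)/(1 + z))`
(`= artanh z`; from Mathlib's `Complex.hasSum_arctan` at `Iz`). [folklore] -/
theorem hasSum_pow_odd_div_log {z : ℂ} (hz : ‖z‖ < 1) :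
    HasSum (fun n : ℕ => z ^ (2 * n + 1) / (2 * n + 1)) (-(1 / 2) * log ((1 - z) / (1 + z))) := by
  have hIz : ‖I * z‖ < 1 := by rwa [norm_mul, norm_I, one_mul]
  have h := (Complex.hasSum_arctan hIz).mul_left (-I)
  have hIzI : I * z * I = -z := by rw [mul_comm I z, mul_assoc, I_mul_I, mul_neg_one]
  have hval : -I * Complex.arctan (I * z) = -(1 / 2) * log ((1 - z) / (1 + z)) := by
    rw [Complex.arctan, hIzI, sub_neg_eq_add, ← sub_eq_add_neg, ← mul_assoc]
    congr 1
    rw [← mul_div_assoc, neg_mul_neg, I_mul_I]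
    ring
  have hfun : (fun n : ℕ => -I * ((-1) ^ n * (I * z) ^ (2 * n + 1) / ((2 * n + 1 : ℕ) : ℂ))) =
      fun n : ℕ => z ^ (2 * n + 1) / (2 * n + 1) := by
    funext n
    push_cast
    rw [mul_pow, pow_succ I (2 * n), pow_mul, I_sq]
    have hI : -I * ((-1 : ℂ) ^ n * ((-1) ^ n * I * z ^ (2 * n + 1))) = z ^ (2 * n + 1) := by
      have h1 : ((-1 : ℂ) ^ n) * (-1) ^ n = 1 := by rw [← mul_pow, neg_one_mul, neg_neg, one_pow]
      calc -I * ((-1 : ℂ) ^ n * ((-1) ^ n * I * z ^ (2 * n + 1)))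
          = -(I * I) * (((-1 : ℂ) ^ n) * (-1) ^ n) * z ^ (2 * n + 1) := by ring
        _ = z ^ (2 * n + 1) := by rw [I_mul_I, h1]; ring
    rw [mul_div_assoc', hI]
  rw [hval, hfun] at h
  exact h

/-- The imaginary part of the odd logarithmic series at `z = r e^{ix}` (`|r| < 1`) is the Abel mean of the
square-wave series: `Σ_n sin((2n+1)x) r^{2n+1}/(2n+1) = Im(-½ log((1 − re^{ix})/(1 + re^{ix})))`. [folklore] -/
theorem tsum_sin_odd_div_mul_pow {x r : ℝ} (hr : |r| < 1) :
    ∑' n : ℕ, Real.sin ((2 * n + 1) * x) / (2 * n + 1) * r ^ (2 * n + 1) =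
      (-(1 / 2) * log ((1 - r * exp (x * I)) / (1 + r * exp (x * I)))).im := by
  have hz : ‖(r : ℂ) * exp (x * I)‖ < 1 := by
    rw [norm_mul, norm_real, Real.norm_eq_abs, norm_exp_ofReal_mul_I, mul_one]; exact hr
  have h := Complex.hasSum_im (hasSum_pow_odd_div_log hz)
  refine (HasSum.tsum_eq ?_)
  convert h using 1
  ext n
  have hk : ((r : ℂ) * exp (x * I)) ^ (2 * n + 1) =
      ((r ^ (2 * n + 1) : ℝ) : ℂ) * exp ((((2 * n + 1 : ℕ) : ℝ) * x : ℝ) * I) := by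
    rw [mul_pow, ← Complex.exp_nat_mul]
    push_cast
    ring_nf
  rw [hk, show ((2 : ℂ) * n + 1) = ((2 * n + 1 : ℕ) : ℂ) by push_cast; ring, Complex.div_natCast_im,
    Complex.im_ofReal_mul, exp_ofReal_mul_I_im]
  push_cast
  ring

/-! ### The limit `S_M(x) → ±π/4` -/

/-- `1 + e^{ix} ≠ 0` when `sin x ≠ 0`. [folklore] -/
theorem one_add_exp_mul_I_ne_zero {x : ℝ} (hx : Real.sin x ≠ 0) : (1 : ℂ) + exp (x * I) ≠ 0 := by
  intro h
  have := congrArg Complex.im h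
  rw [add_im, one_im, exp_ofReal_mul_I_im, zero_add, zero_im] at this
  exact hx this

/-- At the boundary point `z = e^{ix}` with `sin x > 0`, `(1 − z)/(1 + z) = -2i sin x/|1 + z|²` has argument
`-π/2`, so `Im(-½ log((1 − z)/(1 + z))) = π/4`. [folklore] -/
theorem im_neg_half_log_boundary {x : ℝ} (hx : 0 < Real.sin x) :
    (-(1 / 2) * log ((1 - exp (x * I)) / (1 + exp (x * I)))).im = π / 4 := by
  set w : ℂ := exp (x * I) with hw
  have hw_re : w.re = Real.cos x := exp_ofReal_mul_I_re x
  have hw_im : w.im = Real.sin x := exp_ofReal_mul_I_im x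
  have hne : (1 : ℂ) + w ≠ 0 := one_add_exp_mul_I_ne_zero hx.ne'
  have hnsq : 0 < normSq (1 + w) := normSq_pos.2 hne
  have hre : ((1 - w) / (1 + w)).re = 0 := by
    rw [div_re]
    simp only [sub_re, one_re, add_re, sub_im, one_im, add_im, zero_sub, zero_add, hw_re, hw_im]
    have := Real.sin_sq_add_cos_sq x
    field_simp
    nlinarith [this]
  have him : ((1 - w) / (1 + w)).im < 0 := by
    rw [div_im]
    simp only [sub_re, one_re, add_re, sub_im, one_im, add_im, zero_sub, zero_add, hw_re, hw_im]
    rw [← sub_div, div_neg_iff]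
    right
    refine ⟨?_, hnsq⟩
    nlinarith [Real.cos_sq_add_sin_sq x, Real.abs_cos_le_one x, abs_le.1 (Real.abs_cos_le_one x)]
  have harg : arg ((1 - w) / (1 + w)) = -(π / 2) := arg_eq_neg_pi_div_two_iff.2 ⟨hre, him⟩
  rw [mul_im, log_im, harg, log_re]
  simp
  ring

/-- Continuity of the closed form at the boundary: as `r → 1`,
`Im(-½ log((1 − re^{ix})/(1 + re^{ix}))) → Im(-½ log((1 − e^{ix})/(1 + e^{ix})))` (`sin x ≠ 0`: the boundary
value lies off the branch cut). [folklore] -/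
theorem tendsto_im_neg_half_log {x : ℝ} (hx : Real.sin x ≠ 0) :
    Tendsto (fun r : ℝ => (-(1 / 2) * log ((1 - r * exp (x * I)) / (1 + r * exp (x * I)))).im) (𝓝 1)
      (𝓝 ((-(1 / 2) * log ((1 - exp (x * I)) / (1 + exp (x * I)))).im)) := by
  set w : ℂ := exp (x * I) with hw
  have hne : (1 : ℂ) + w ≠ 0 := one_add_exp_mul_I_ne_zero hx
  -- the Möbius map `r ↦ (1 - r w)/(1 + r w)` is continuous at `r = 1`
  have hq : ContinuousAt (fun r : ℝ => (1 - (r : ℂ) * w) / (1 + (r : ℂ) * w)) 1 := by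
    refine ContinuousAt.div ?_ ?_ (by simpa using hne)
    · exact (continuous_const.sub (continuous_ofReal.mul continuous_const)).continuousAt
    · exact (continuous_const.add (continuous_ofReal.mul continuous_const)).continuousAt
  -- its value at `r = 1` is off the branch cut: imaginary part `-2 sin x/|1+w|² ≠ 0`
  have hslit : (1 - w) / (1 + w) ∈ slitPlane := by
    rw [mem_slitPlane_iff]
    right
    rw [div_im]
    simp only [sub_re, one_re, add_re, sub_im, one_im, add_im, zero_sub, zero_add, hw,
      exp_ofReal_mul_I_re, exp_ofReal_mul_I_im]
    rw [← sub_div]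
    refine div_ne_zero ?_ (normSq_pos.2 hne).ne'
    nlinarith [Real.cos_sq_add_sin_sq x, abs_le.1 (Real.abs_cos_le_one x), hx.lt_or_gt,
      sq_pos_of_ne_zero hx]
  have hq1' : (1 - ((1 : ℝ) : ℂ) * w) / (1 + ((1 : ℝ) : ℂ) * w) = (1 - w) / (1 + w) := by simp
  have hlog : ContinuousAt (log ∘ fun r : ℝ => (1 - (r : ℂ) * w) / (1 + (r : ℂ) * w)) 1 :=
    (continuousAt_clog hslit).comp_of_eq hq hq1'
  have h2 : Tendsto (fun r : ℝ => -(1 / 2) * log ((1 - (r : ℂ) * w) / (1 + (r : ℂ) * w))) (𝓝 1)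
      (𝓝 (-(1 / 2) * log ((1 - w) / (1 + w)))) := by
    have := hlog.tendsto
    rw [Function.comp_apply, hq1'] at this
    exact this.const_mul _
  exact (continuous_im.tendsto _).comp h2

/-- **The square-wave series at a point with `sin x > 0`**: `Σ_{n<M} sin((2n+1)x)/(2n+1) → π/4`
(Zygmund, *Trigonometric Series* I, Ch. II §9; Dirichlet's test + Abel's limit theorem, as in Mathlib's
`Real.tendsto_sum_pi_div_four`, which is the case `x = π/2`). [folklore] -/
theorem tendsto_sum_sin_odd_div_of_sin_pos {x : ℝ} (hx : 0 < Real.sin x) :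
    Tendsto (fun M : ℕ => ∑ n ∈ range M, Real.sin ((2 * n + 1) * x) / (2 * n + 1)) atTop (𝓝 (π / 4)) := by
  -- Step 1: Dirichlet's test — the partial sums converge to some `l`
  obtain ⟨l, hl⟩ : ∃ l : ℝ,
      Tendsto (fun M : ℕ => ∑ n ∈ range M, Real.sin ((2 * n + 1) * x) / (2 * n + 1)) atTop (𝓝 l) := by
    have ha : Antitone fun n : ℕ => 1 / (2 * (n : ℝ) + 1) := fun m n hmn =>
      one_div_le_one_div_of_le (by positivity) (by simpa using (Nat.cast_le (α := ℝ)).2 hmn)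
    have h0 : Tendsto (fun n : ℕ => 1 / (2 * (n : ℝ) + 1)) atTop (𝓝 0) := by
      simp_rw [one_div]
      apply Tendsto.inv_tendsto_atTop
      exact tendsto_atTop_add_const_right _ _ (tendsto_natCast_atTop_atTop.const_mul_atTop zero_lt_two)
    have hc := ha.cauchySeq_series_mul_of_tendsto_zero_of_bounded (z := fun n : ℕ => Real.sin ((2 * n + 1) * x))
      (b := 1 / |Real.sin x|) h0 (fun n => (Real.norm_eq_abs _).le.trans (abs_sum_sin_odd_le hx.ne' n))
    obtain ⟨l, hl⟩ := cauchySeq_tendsto_of_complete hc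
    exact ⟨l, hl.congr fun M => sum_congr rfl fun n _ => by rw [smul_eq_mul]; ring⟩
  -- Step 2: Abel's limit theorem along `y = r²`, times `r`
  have abel := Real.tendsto_tsum_powerSeries_nhdsWithin_lt hl
  have m : 𝓝[<] (1 : ℝ) ≤ 𝓝 1 := tendsto_nhdsWithin_of_tendsto_nhds fun _ a => a
  have q : Tendsto (fun r : ℝ => r ^ 2) (𝓝[<] 1) (𝓝[<] 1) := by
    apply tendsto_nhdsWithin_of_tendsto_nhds_of_eventually_within
    · nth_rw 3 [← one_pow 2]
      exact Tendsto.pow (tendsto_nhdsWithin_of_tendsto_nhds fun _ a => a) _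
    · rw [eventually_iff_exists_mem]
      refine ⟨Set.Ioo (-1) 1, Ioo_mem_nhdsLT (by norm_num), fun y hy => ?_⟩
      rw [Set.mem_Iio, sq_lt_one_iff_abs_lt_one, abs_lt]
      exact hy
  replace abel := (abel.comp q).mul m
  rw [mul_one] at abel
  -- rewrite the Abel means as the imaginary part of the closed form
  replace abel : Tendsto (fun r : ℝ =>
      (-(1 / 2) * log ((1 - r * exp (x * I)) / (1 + r * exp (x * I)))).im) (𝓝[<] 1) (𝓝 l) := by
    apply abel.congr'
    rw [eventuallyEq_nhdsWithin_iff, Metric.eventually_nhds_iff]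
    refine ⟨1, zero_lt_one, fun r hr1 hr2 => ?_⟩
    rw [Real.dist_eq, abs_sub_lt_iff] at hr1
    rw [Set.mem_Iio] at hr2
    have hr : |r| < 1 := by rw [abs_lt]; constructor <;> linarith
    rw [← tsum_sin_odd_div_mul_pow hr, Function.comp_apply, ← tsum_mul_right]
    refine tsum_congr fun n => ?_
    rw [← pow_mul, pow_succ, mul_comm 2 n]
    ring
  -- Step 3: the closed form is continuous at `r = 1` with boundary value `π/4`
  have hlim := ((tendsto_im_neg_half_log hx.ne').mono_left m)
  rw [im_neg_half_log_boundary hx] at hlim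
  rwa [tendsto_nhds_unique abel hlim] at hl

/-- **The square-wave series at a point with `sin x < 0`**: `Σ_{n<M} sin((2n+1)x)/(2n+1) → -π/4`. [folklore] -/
theorem tendsto_sum_sin_odd_div_of_sin_neg {x : ℝ} (hx : Real.sin x < 0) :
    Tendsto (fun M : ℕ => ∑ n ∈ range M, Real.sin ((2 * n + 1) * x) / (2 * n + 1)) atTop
      (𝓝 (-(π / 4))) := by
  have hx' : 0 < Real.sin (-x) := by rw [Real.sin_neg]; linarith
  have h := (tendsto_sum_sin_odd_div_of_sin_pos hx').neg
  refine h.congr fun M => ?_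
  rw [← sum_neg_distrib]
  refine sum_congr rfl fun n _ => ?_
  rw [mul_neg, Real.sin_neg, neg_div, neg_neg]

/-- The three cases together: `Σ_{n<M} sin((2n+1)x)/(2n+1) → (π/4)·sgn(sin x)`. [folklore] -/
theorem tendsto_sum_sin_odd_div (x : ℝ) :
    Tendsto (fun M : ℕ => ∑ n ∈ range M, Real.sin ((2 * n + 1) * x) / (2 * n + 1)) atTop
      (𝓝 (π / 4 * SignType.sign (Real.sin x))) := by
  rcases lt_trichotomy (Real.sin x) 0 with hx | hx | hx
  · rw [sign_neg hx]; simpa using tendsto_sum_sin_odd_div_of_sin_neg hx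
  · rw [hx, sign_zero]
    simp only [SignType.coe_zero, mul_zero, sum_sin_odd_div_of_sin_eq_zero hx]
    exact tendsto_const_nhds
  · rw [sign_pos hx]; simpa using tendsto_sum_sin_odd_div_of_sin_pos hx

end Literature.Analysis.Fourier
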